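import Mathlib
import HarnessLib
import Summits.ValiantsHypothesis.ValiantsHypothesis.Theses.MonotoneRestoration
import Summits.ValiantsHypothesis.ValiantsHypothesis.Theorems.MonotoneRestorationQP.Negative.OrbitRestorationFalseOfPolylogWidthVP

/-!
# Route MonotoneRestoration — the kill glue of the binder in ORBIT currency, on the route's named decls:
# `PolylogWidthMonotoneEasy → ¬ OrbitRestorationQP` and `PolylogWidthVP → ¬ OrbitRestorationQP`

The route file (`Theses/MonotoneRestoration.lean`, § Assembly and KILL CRITERIA) invites as a `--supports`
landing the ORBIT form of the proved kill glue `WidthKillsRestoration`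
(`PolylogWidthMonotoneEasy → ¬ MonotoneRestorationQP`, size currency): the kill witness
`PolylogWidthMonotoneEasy` (item stmt-ValiantsHypothesis-17619: a matrix-symmetric monotone-easy family of
counting width `ω(polylog)`) refutes the binder `OrbitRestorationQP` (item stmt-ValiantsHypothesis-18293)
DIRECTLY, by the Dawar–Wilsenach orbit pipeline (threshold translation `thresholdCircuit_orbitSize_le`,
reduced rigidification with supports `exists_reduced_rigidification_supports`, per-order invariance
`eval_adjInput_eq_of_ckEquiv`).  The pipeline is already run in the tree, against the binder's statement
QUOTED INLINE (it predates the 2026-08-17 re-glue that made `OrbitRestorationQP` a route decl):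
`Theorems/MonotoneRestorationQP/Negative/OrbitRestorationFalseOfPolylogWidthVP.lean`
(`stub_orbitRestoration_false_of_polylogWidthMonotoneEasy`, `stub_orbitRestoration_false_of_polylogWidthVP`).
This file restates both conclusions on the route's NAMED declaration `OrbitRestorationQP` (definitionally
the same statement), so that the cone's kill path through the witness is visible by name:

* `orbitRestorationQP_false_of_polylogWidthMonotoneEasy : PolylogWidthMonotoneEasy → ¬ OrbitRestorationQP`;
* `orbitRestorationQP_false_of_polylogWidthVP : PolylogWidthVP → ¬ OrbitRestorationQP` (the weakest typed
  kill hypothesis: any matrix-symmetric `VP` family over `ℂ` of counting width `ω(polylog)` on graphs —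
  an "arithmetic CFI family in characteristic 0", Dawar–Wilsenach 2025 §8; none is known).

Both items stay open; VP ≠ VNP is not touched (refuting the binder would NOT bear on the summit, and
`¬ PolylogWidthMonotoneEasy` is itself at least summit-hard, `valiantsHypothesis_of_not_polylogWidthMonotoneEasy`).

## References
* A. Dawar, G. Wilsenach, *Symmetric arithmetic circuits*, ToC 21 (2025), Thm 5.1, Thms 6.2–6.4, §8.
  [DawarWilsenach2025]
* M. Anderson, A. Dawar, *On symmetric circuits and fixed-point logics*, Theory Comput. Syst. 60 (2017).
  [AndersonDawar2016]
-/

-- `Summit.ValiantsHypothesis.ValiantsHypothesis.…` is the tree's single-conjunct layout (Sub = Summit).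
set_option linter.dupNamespace false

namespace Summit.ValiantsHypothesis.ValiantsHypothesis.Theorems

open Summit.ValiantsHypothesis.ValiantsHypothesis.Theses.MonotoneRestoration

/-- **Kill glue in orbit currency, named form**: the route's kill witness refutes the binder —
`PolylogWidthMonotoneEasy → ¬ OrbitRestorationQP` (the orbit-strength form of the proved
`WidthKillsRestoration`; the Dawar–Wilsenach pipeline of
`stub_orbitRestoration_false_of_polylogWidthMonotoneEasy`, whose inline statement of the binder is
definitionally `OrbitRestorationQP`). [cite: DawarWilsenach2025, Thms 5.1 and 6.2–6.4] -/
theorem orbitRestorationQP_false_of_polylogWidthMonotoneEasy :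
    PolylogWidthMonotoneEasy → ¬ OrbitRestorationQP :=
  fun h => stub_orbitRestoration_false_of_polylogWidthMonotoneEasy h

/-- **The weakest typed kill hypothesis refutes the binder, named form**: a matrix-symmetric `VP`
family over `ℂ` of counting width `ω(polylog)` on graphs (`PolylogWidthVP`, the refuter's construction
item; no example is known — Dawar–Wilsenach 2025 §8) gives `¬ OrbitRestorationQP`.
[cite: DawarWilsenach2025, Thms 5.1 and 6.2–6.4, §8] -/
theorem orbitRestorationQP_false_of_polylogWidthVP : PolylogWidthVP → ¬ OrbitRestorationQP :=
  fun h => stub_orbitRestoration_false_of_polylogWidthVP h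

end Summit.ValiantsHypothesis.ValiantsHypothesis.Theorems
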